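import Mathlib
import Literature.NumberTheory.Transcendental.AssociatorsEval
import Literature.NumberTheory.Transcendental.AssociatorsBarIntegrable
import HarnessLib

/-!
# Pairing bar elements with group-like series (duality `ш ↔ Δ`, pushforwards, products)

Sibling file of `Associators.lean` (Part B.5a of the proof of `furusho_pentagon_doubleShuffle`
[Furusho2011, Thm 1.2]); folklore Hopf-algebra calculus, everything proved, no named facts.
Furusho evaluates elements `l` of `V(M_{0,5})` (functionals on words) at group-like elements `g`
of `U𝔓₅^∧` and uses "`l₁ · l₂ (g) = l₁(g) l₂(g)`" (`V(M)` is the coordinate ring of the group of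
group-like elements, [Furusho2011, §3]) and the coproduct `δ` of `V(M_{0,5})` [§5]. Here, with
`K`-valued functionals `ψ : List α → K` and series `G ∈ K⟨⟨α⟩⟩` (`NCSeries α K`):

* `shufK` — the shuffle product of `K`-valued functionals (Leibniz recursion), `BarFun.castK` — the
  bar elements of `AssociatorsBar.lean` with coefficients cast to `K`;
* `pairLen n ψ G = Σ_{|z| = n} ψ(z) c_z(G)` — the weight-`n` pairing;
* `pairLen_shufK` — **duality** `⟨ψ ш ψ', G⟩_n = Σ_{i+j=n} Σ_{u,v} ψ(u) ψ'(v) Sh_G(u,v)`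
  (`Sh_G` = `NCSeries.shPair`, the shuffle coproduct), hence for GROUP-LIKE `G` the pairing is
  multiplicative: `⟨ψ ш ψ', G⟩ = ⟨ψ, G⟩ ⟨ψ', G⟩` (`pairLen_shufK_of_isGroupLike`);
* `NCSeries.shPair_mul` — the bialgebra axiom `Δ(G H) = Δ(G) Δ(H)` in coefficient form, whence
  `NCSeries.IsGroupLike.mul`: products of group-like series are group-like;
* `NCSeries.push m φ` — the image of `φ ∈ K⟨⟨β⟩⟩` under a linear substitution of letters
  `b ↦ Σ_f m(b,f) f` (Furusho's `φ(ι(X₀), ι(X₁))` for `ι` linear on letters, transposed to words),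
  its recursion, `NCSeries.IsGroupLike.push` (group-likeness is preserved), and the closed form
  `NCSeries.push_of_monomial` for "monomial" substitutions (each letter having at most one preimage);
* homogeneity (`Homog`) and the weights of the bar elements.

## References

* H. Furusho, *Double shuffle relation for associators*, Ann. of Math. 174 (2011), §3, §5. [Furusho2011]
* C. Reutenauer, *Free Lie algebras*, Oxford (1993), §1.4–1.5, Thm 3.2. [Reutenauer1993]
-/

noncomputable section

open scoped BigOperators

namespace Literature.NumberTheory.Transcendental

universe u v

/-! ## B.5a.1 `K`-valued functionals and their shuffle product -/

section ShufK

variable {α : Type u} {K : Type v}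

/-- Left derivative of a functional: `derK f ψ w = ψ (f w)`. [folklore] -/
def derK (f : α) (ψ : List α → K) : List α → K := fun w => ψ (f :: w)

/-- `derK f ψ w = ψ (f w)`. [folklore] -/
@[simp] theorem derK_apply (f : α) (ψ : List α → K) (w : List α) : derK f ψ w = ψ (f :: w) := rfl

variable [CommRing K]

/-- The **shuffle product** of `K`-valued functionals, by the Leibniz recursion. [folklore] -/
def shufK : (List α → K) → (List α → K) → List α → K
  | ψ, ψ', [] => ψ [] * ψ' []
  | ψ, ψ', f :: w => shufK (derK f ψ) ψ' w + shufK ψ (derK f ψ') w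

/-- `(ψ ш ψ')(∅) = ψ(∅) ψ'(∅)`. [folklore] -/
@[simp] theorem shufK_nil (ψ ψ' : List α → K) : shufK ψ ψ' [] = ψ [] * ψ' [] := rfl

/-- Leibniz rule. [folklore] -/
theorem shufK_cons (ψ ψ' : List α → K) (f : α) (w : List α) :
    shufK ψ ψ' (f :: w) = shufK (derK f ψ) ψ' w + shufK ψ (derK f ψ') w := rfl

end ShufK

namespace BarFun

variable {K : Type v} [CommRing K]

/-- A bar element with its integer coefficients cast to `K`. [folklore] -/
def castK (L : BarFun) : List F5 → K := fun w => (L w : K)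

/-- `castK L w = L w`. [folklore] -/
@[simp] theorem castK_apply (L : BarFun) (w : List F5) : (castK L : List F5 → K) w = (L w : K) := rfl

/-- `castK` commutes with `der`. [folklore] -/
theorem derK_castK (f : F5) (L : BarFun) : derK f (castK (K := K) L) = castK (der f L) := rfl

/-- `castK` is additive. [folklore] -/
@[simp] theorem castK_add (L L' : BarFun) : castK (K := K) (L + L') = castK L + castK L' := by
  funext w; simp

/-- `castK` respects subtraction. [folklore] -/
@[simp] theorem castK_sub (L L' : BarFun) : castK (K := K) (L - L') = castK L - castK L' := by
  funext w; simp

/-- `castK` respects negation. [folklore] -/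
@[simp] theorem castK_neg (L : BarFun) : castK (K := K) (-L) = -castK L := by
  funext w; simp

/-- `castK 0 = 0`. [folklore] -/
@[simp] theorem castK_zero : castK (K := K) 0 = 0 := by
  funext w; simp

/-- `castK` commutes with list sums. [folklore] -/
theorem castK_list_sum {ι : Type*} (l : List ι) (G : ι → BarFun) :
    castK (K := K) (l.map G).sum = (l.map fun i => castK (K := K) (G i)).sum := by
  induction l with
  | nil => simp
  | cons i l ih => simp [ih]

/-- `castK` commutes with finite sums. [folklore] -/
theorem castK_finset_sum {ι : Type*} (s : Finset ι) (G : ι → BarFun) :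
    castK (K := K) (∑ i ∈ s, G i) = ∑ i ∈ s, castK (K := K) (G i) := by
  classical
  induction s using Finset.induction_on with
  | empty => simp
  | insert i s hi ih => rw [Finset.sum_insert hi, Finset.sum_insert hi, castK_add, ih]

/-- **`castK` is multiplicative for the shuffle products.** [folklore] -/
theorem castK_shuf (L L' : BarFun) : castK (K := K) (shuf L L') = shufK (castK L) (castK L') := by
  suffices h : ∀ (w : List F5) (L L' : BarFun), castK (K := K) (shuf L L') w = shufK (castK L) (castK L') w from
    funext fun w => h w L L'
  intro w
  induction w with
  | nil => intro L L'; simp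
  | cons f w ih =>
    intro L L'
    rw [shufK_cons, derK_castK, derK_castK, ← ih, ← ih]
    simp [castK, shuf]

end BarFun

/-! ## B.5a.2 The weight-`n` pairing and the duality `ш ↔ Δ` -/

section Pairing

variable {α : Type u} {K : Type v} [CommRing K] [Fintype α]

/-- The weight-`n` pairing of a functional with a series: `⟨ψ, G⟩_n = Σ_{|z| = n} ψ(z) c_z(G)`.
[folklore] -/
def pairLen (n : ℕ) (ψ : List α → K) (G : NCSeries α K) : K :=
  ∑ f : Fin n → α, ψ (List.ofFn f) * G (List.ofFn f)

/-- `⟨ψ, G⟩_0 = ψ(∅) c_∅(G)`. [folklore] -/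
@[simp] theorem pairLen_zero (ψ : List α → K) (G : NCSeries α K) : pairLen 0 ψ G = ψ [] * G [] := by
  simp [pairLen]

/-- Recursion: `⟨ψ, G⟩_{n+1} = Σ_f ⟨∂_f ψ, ∂_f G⟩_n`. [folklore] -/
theorem pairLen_succ (n : ℕ) (ψ : List α → K) (G : NCSeries α K) :
    pairLen (n + 1) ψ G = ∑ f : α, pairLen n (derK f ψ) (NCSeries.lderiv f G) := by
  rw [pairLen, NCSeries.sum_fin_succ_fun]
  refine Finset.sum_congr rfl fun f _ => ?_
  rw [pairLen]
  refine Finset.sum_congr rfl fun g _ => ?_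
  rw [List.ofFn_cons]
  rfl

/-- The pairing is additive in the functional. [folklore] -/
theorem pairLen_add_left (n : ℕ) (ψ ψ' : List α → K) (G : NCSeries α K) :
    pairLen n (ψ + ψ') G = pairLen n ψ G + pairLen n ψ' G := by
  simp [pairLen, add_mul, Finset.sum_add_distrib]

/-- The pairing respects negation in the functional. [folklore] -/
theorem pairLen_neg_left (n : ℕ) (ψ : List α → K) (G : NCSeries α K) :
    pairLen n (-ψ) G = -pairLen n ψ G := by
  simp [pairLen, Finset.sum_neg_distrib]

/-- The pairing respects subtraction in the functional. [folklore] -/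
theorem pairLen_sub_left (n : ℕ) (ψ ψ' : List α → K) (G : NCSeries α K) :
    pairLen n (ψ - ψ') G = pairLen n ψ G - pairLen n ψ' G := by
  simp [pairLen, sub_mul, Finset.sum_sub_distrib]

/-- The pairing is additive in the series. [folklore] -/
theorem pairLen_add_right (n : ℕ) (ψ : List α → K) (G G' : NCSeries α K) :
    pairLen n ψ (G + G') = pairLen n ψ G + pairLen n ψ G' := by
  simp [pairLen, mul_add, Finset.sum_add_distrib]

/-- The pairing is homogeneous in the series. [folklore] -/
theorem pairLen_smul_right (n : ℕ) (ψ : List α → K) (c : K) (G : NCSeries α K) :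
    pairLen n ψ (c • G) = c * pairLen n ψ G := by
  simp [pairLen, Finset.mul_sum, mul_left_comm]

/-- The `(i, j)` piece of the dual side: `Σ_{|u|=i,|v|=j} ψ(u) ψ'(v) Sh_G(u, v)`. [folklore] -/
def shDual₂ (i j : ℕ) (ψ ψ' : List α → K) (G : NCSeries α K) : K :=
  ∑ f : Fin i → α, ∑ g : Fin j → α,
    ψ (List.ofFn f) * ψ' (List.ofFn g) * NCSeries.shPair G (List.ofFn f) (List.ofFn g)

/-- `shDual₂ 0 0 = ψ(∅) ψ'(∅) c_∅(G)`. [folklore] -/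
@[simp] theorem shDual₂_zero_zero (ψ ψ' : List α → K) (G : NCSeries α K) :
    shDual₂ 0 0 ψ ψ' G = ψ [] * ψ' [] * G [] := by
  simp [shDual₂]

/-- Left recursion with empty right word. [folklore] -/
theorem shDual₂_succ_zero (i : ℕ) (ψ ψ' : List α → K) (G : NCSeries α K) :
    shDual₂ (i + 1) 0 ψ ψ' G = ∑ a : α, shDual₂ i 0 (derK a ψ) ψ' (NCSeries.lderiv a G) := by
  simp only [shDual₂, Fintype.sum_unique, List.ofFn_zero]
  rw [NCSeries.sum_fin_succ_fun]
  refine Finset.sum_congr rfl fun a _ => Finset.sum_congr rfl fun f _ => ?_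
  rw [List.ofFn_cons, NCSeries.shPair_cons_nil]
  rfl

/-- Right recursion with empty left word. [folklore] -/
theorem shDual₂_zero_succ (j : ℕ) (ψ ψ' : List α → K) (G : NCSeries α K) :
    shDual₂ 0 (j + 1) ψ ψ' G = ∑ b : α, shDual₂ 0 j ψ (derK b ψ') (NCSeries.lderiv b G) := by
  simp only [shDual₂, Fintype.sum_unique, List.ofFn_zero]
  rw [NCSeries.sum_fin_succ_fun]
  refine Finset.sum_congr rfl fun b _ => Finset.sum_congr rfl fun g _ => ?_
  rw [List.ofFn_cons, NCSeries.shPair_nil_cons]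
  rfl

/-- Two-sided recursion. [folklore] -/
theorem shDual₂_succ_succ (i j : ℕ) (ψ ψ' : List α → K) (G : NCSeries α K) :
    shDual₂ (i + 1) (j + 1) ψ ψ' G = ∑ a : α, shDual₂ i (j + 1) (derK a ψ) ψ' (NCSeries.lderiv a G) +
      ∑ b : α, shDual₂ (i + 1) j ψ (derK b ψ') (NCSeries.lderiv b G) := by
  have h1 : shDual₂ (i + 1) (j + 1) ψ ψ' G = ∑ a : α, ∑ f : Fin i → α, ∑ b : α, ∑ g : Fin j → α,
      ψ (a :: List.ofFn f) * ψ' (b :: List.ofFn g) *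
        (NCSeries.shPair (NCSeries.lderiv a G) (List.ofFn f) (b :: List.ofFn g) +
          NCSeries.shPair (NCSeries.lderiv b G) (a :: List.ofFn f) (List.ofFn g)) := by
    unfold shDual₂
    rw [NCSeries.sum_fin_succ_fun (M := K) (n := i)]
    refine Finset.sum_congr rfl fun a _ => Finset.sum_congr rfl fun f _ => ?_
    rw [NCSeries.sum_fin_succ_fun (M := K) (n := j)]
    refine Finset.sum_congr rfl fun b _ => Finset.sum_congr rfl fun g _ => ?_
    rw [List.ofFn_cons, List.ofFn_cons, NCSeries.shPair_cons_cons]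
  have hA : ∑ a : α, shDual₂ i (j + 1) (derK a ψ) ψ' (NCSeries.lderiv a G) =
      ∑ a : α, ∑ f : Fin i → α, ∑ b : α, ∑ g : Fin j → α,
        ψ (a :: List.ofFn f) * ψ' (b :: List.ofFn g) *
          NCSeries.shPair (NCSeries.lderiv a G) (List.ofFn f) (b :: List.ofFn g) := by
    refine Finset.sum_congr rfl fun a _ => ?_
    unfold shDual₂
    refine Finset.sum_congr rfl fun f _ => ?_
    rw [NCSeries.sum_fin_succ_fun (M := K) (n := j)]
    refine Finset.sum_congr rfl fun b _ => Finset.sum_congr rfl fun g _ => ?_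
    rw [List.ofFn_cons]
    rfl
  have hB : ∑ b : α, shDual₂ (i + 1) j ψ (derK b ψ') (NCSeries.lderiv b G) =
      ∑ a : α, ∑ f : Fin i → α, ∑ b : α, ∑ g : Fin j → α,
        ψ (a :: List.ofFn f) * ψ' (b :: List.ofFn g) *
          NCSeries.shPair (NCSeries.lderiv b G) (a :: List.ofFn f) (List.ofFn g) := by
    have step : ∀ b : α, shDual₂ (i + 1) j ψ (derK b ψ') (NCSeries.lderiv b G) =
        ∑ a : α, ∑ f : Fin i → α, ∑ g : Fin j → α,
          ψ (a :: List.ofFn f) * ψ' (b :: List.ofFn g) *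
            NCSeries.shPair (NCSeries.lderiv b G) (a :: List.ofFn f) (List.ofFn g) := by
      intro b
      unfold shDual₂
      rw [NCSeries.sum_fin_succ_fun (M := K) (n := i)]
      refine Finset.sum_congr rfl fun a _ => Finset.sum_congr rfl fun f _ => Finset.sum_congr rfl fun g _ => ?_
      rw [List.ofFn_cons]
      rfl
    simp only [step]
    rw [Finset.sum_comm]
    refine Finset.sum_congr rfl fun a _ => ?_
    rw [Finset.sum_comm]
  rw [h1, hA, hB, ← Finset.sum_add_distrib]
  refine Finset.sum_congr rfl fun a _ => ?_
  rw [← Finset.sum_add_distrib]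
  refine Finset.sum_congr rfl fun f _ => ?_
  rw [← Finset.sum_add_distrib]
  refine Finset.sum_congr rfl fun b _ => ?_
  rw [← Finset.sum_add_distrib]
  refine Finset.sum_congr rfl fun g _ => ?_
  rw [mul_add]

/-- **Duality `ш ↔ Δ`**: `⟨ψ ш ψ', G⟩_n = Σ_{i+j=n} Σ_{|u|=i,|v|=j} ψ(u) ψ'(v) Sh_G(u,v)` — the shuffle
product of functionals is the transpose of the coproduct `Δ` of `K⟨⟨α⟩⟩` with primitive letters
[Reutenauer1993, §1.5]. Proof by induction on `n` through the Leibniz rule and the transposed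
shuffle recursion `NCSeries.shPair_cons_cons`. [cite: Reutenauer1993, §1.5] -/
theorem pairLen_shufK : ∀ (n : ℕ) (ψ ψ' : List α → K) (G : NCSeries α K),
    pairLen n (shufK ψ ψ') G =
      ∑ p ∈ Finset.HasAntidiagonal.antidiagonal n, shDual₂ p.1 p.2 ψ ψ' G
  | 0, ψ, ψ', G => by simp
  | n + 1, ψ, ψ', G => by
    let L : ℕ → ℕ → K := fun i j =>
      match i with
      | 0 => 0
      | i + 1 => ∑ a : α, shDual₂ i j (derK a ψ) ψ' (NCSeries.lderiv a G)
    let Rt : ℕ → ℕ → K := fun i j =>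
      match j with
      | 0 => 0
      | j + 1 => ∑ b : α, shDual₂ i j ψ (derK b ψ') (NCSeries.lderiv b G)
    have hsplit : ∀ p ∈ Finset.HasAntidiagonal.antidiagonal (n + 1),
        shDual₂ p.1 p.2 ψ ψ' G = L p.1 p.2 + Rt p.1 p.2 := by
      rintro ⟨i, j⟩ hp
      rw [Finset.HasAntidiagonal.mem_antidiagonal] at hp
      match i, j, hp with
      | 0, j + 1, _ => simp only [L, Rt, shDual₂_zero_succ, zero_add]
      | i + 1, 0, _ => simp only [L, Rt, shDual₂_succ_zero, add_zero]
      | i + 1, j + 1, _ => simp only [L, Rt, shDual₂_succ_succ i j]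
    have hLsum : ∑ p ∈ Finset.HasAntidiagonal.antidiagonal (n + 1), L p.1 p.2 =
        ∑ a : α, ∑ q ∈ Finset.HasAntidiagonal.antidiagonal n,
          shDual₂ q.1 q.2 (derK a ψ) ψ' (NCSeries.lderiv a G) := by
      rw [Finset.Nat.sum_antidiagonal_succ]
      simp only [L, zero_add]
      exact Finset.sum_comm
    have hRsum : ∑ p ∈ Finset.HasAntidiagonal.antidiagonal (n + 1), Rt p.1 p.2 =
        ∑ b : α, ∑ q ∈ Finset.HasAntidiagonal.antidiagonal n,
          shDual₂ q.1 q.2 ψ (derK b ψ') (NCSeries.lderiv b G) := by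
      rw [Finset.Nat.sum_antidiagonal_succ']
      simp only [Rt, zero_add]
      exact Finset.sum_comm
    rw [Finset.sum_congr rfl hsplit, Finset.sum_add_distrib, hLsum, hRsum, pairLen_succ,
      ← Finset.sum_add_distrib]
    refine Finset.sum_congr rfl fun a _ => ?_
    have hder : derK a (shufK ψ ψ') = shufK (derK a ψ) ψ' + shufK ψ (derK a ψ') := by
      funext w; rfl
    rw [hder, pairLen_add_left, pairLen_shufK n, pairLen_shufK n]

/-- **For a group-like series the pairing is multiplicative**: `⟨ψ ш ψ', G⟩_n =
Σ_{i+j=n} ⟨ψ, G⟩_i ⟨ψ', G⟩_j` ("group-like elements are characters of the shuffle algebra":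
Furusho's "`V(M)` is the regular function ring of the group-like elements", [Furusho2011, §3]).
[cite: Reutenauer1993, Thm 3.2] -/
theorem pairLen_shufK_of_isGroupLike (n : ℕ) (ψ ψ' : List α → K) {G : NCSeries α K}
    (hG : NCSeries.IsGroupLike G) :
    pairLen n (shufK ψ ψ') G =
      ∑ p ∈ Finset.HasAntidiagonal.antidiagonal n, pairLen p.1 ψ G * pairLen p.2 ψ' G := by
  rw [pairLen_shufK]
  refine Finset.sum_congr rfl fun p _ => ?_
  rw [shDual₂, pairLen, pairLen, Finset.sum_mul_sum]
  refine Finset.sum_congr rfl fun f _ => Finset.sum_congr rfl fun g _ => ?_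
  rw [NCSeries.shPair, ← hG.2]
  ring

/-! ### Homogeneous functionals -/

/-- `ψ` is **homogeneous of weight `W`**: it vanishes on words of other lengths. [folklore] -/
def Homog (W : ℕ) (ψ : List α → K) : Prop := ∀ w : List α, w.length ≠ W → ψ w = 0

/-- The pairing of a homogeneous functional vanishes in other weights. [folklore] -/
theorem pairLen_eq_zero_of_homog {W n : ℕ} {ψ : List α → K} (h : Homog W ψ) (hn : n ≠ W)
    (G : NCSeries α K) : pairLen n ψ G = 0 := by
  refine Finset.sum_eq_zero fun f _ => ?_
  rw [h _ (by simpa using hn), zero_mul]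

/-- **Multiplicativity in fixed weights**: for `ψ` homogeneous of weight `W`, any `ψ'` and a
group-like `G`, `⟨ψ ш ψ', G⟩_{W+W'} = ⟨ψ, G⟩_W ⟨ψ', G⟩_{W'}`. [cite: Reutenauer1993, Thm 3.2] -/
theorem pairLen_shufK_homog {W : ℕ} (W' : ℕ) {ψ : List α → K} (ψ' : List α → K) (hψ : Homog W ψ)
    {G : NCSeries α K} (hG : NCSeries.IsGroupLike G) :
    pairLen (W + W') (shufK ψ ψ') G = pairLen W ψ G * pairLen W' ψ' G := by
  rw [pairLen_shufK_of_isGroupLike _ _ _ hG,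
    Finset.sum_eq_single_of_mem (W, W') (by simp) fun p hp hne => ?_]
  rw [Finset.HasAntidiagonal.mem_antidiagonal] at hp
  by_cases h1 : p.1 = W
  · have h2 : p.2 = W' := by omega
    exact absurd (Prod.ext h1 h2) hne
  · rw [pairLen_eq_zero_of_homog hψ h1, zero_mul]

end Pairing

/-! ## B.5a.3 The bialgebra axiom `Δ(G H) = Δ(G) Δ(H)`; products of group-like series -/

namespace NCSeries

variable {α : Type u} {K : Type v} [CommRing K]

/-- `Sh` is additive in the series. [folklore] -/
theorem shPair_add (G G' : NCSeries α K) (u v : List α) :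
    shPair (G + G') u v = shPair G u v + shPair G' u v := by
  unfold shPair
  generalize MZV.shuffleWord u v = L
  induction L with
  | nil => simp
  | cons w L ih => simp only [List.map_cons, List.sum_cons, add_apply, ih]; abel

/-- `Sh_{C r · G} = r Sh_G`. [folklore] -/
theorem shPair_C_mul (r : K) (G : NCSeries α K) (u v : List α) :
    shPair (C r * G) u v = r * shPair G u v := by
  unfold shPair
  generalize MZV.shuffleWord u v = L
  induction L with
  | nil => simp
  | cons w L ih => simp only [List.map_cons, List.sum_cons, C_mul_apply, ih]; ring

/-- `Sh_{r • G} = r Sh_G`. [folklore] -/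
theorem shPair_smul (r : K) (G : NCSeries α K) (u v : List α) :
    shPair (r • G) u v = r * shPair G u v := by
  unfold shPair
  generalize MZV.shuffleWord u v = L
  induction L with
  | nil => simp
  | cons w L ih => simp only [List.map_cons, List.sum_cons, smul_apply, smul_eq_mul, ih]; ring

/-- `Sh_0 = 0`. [folklore] -/
@[simp] theorem shPair_zero (u v : List α) : shPair (0 : NCSeries α K) u v = 0 := by
  unfold shPair
  generalize MZV.shuffleWord u v = L
  induction L with
  | nil => simp
  | cons w L ih => simp only [List.map_cons, List.sum_cons, zero_apply, ih, add_zero]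

/-- `Sh` commutes with finite sums of series. [folklore] -/
theorem shPair_finset_sum {ι : Type*} (s : Finset ι) (G : ι → NCSeries α K) (u v : List α) :
    shPair (∑ i ∈ s, G i) u v = ∑ i ∈ s, shPair (G i) u v := by
  classical
  induction s using Finset.induction_on with
  | empty => simp
  | insert i s hi ih => rw [Finset.sum_insert hi, Finset.sum_insert hi, shPair_add, ih]

/-- `splits [] = {([], [])}` in summed form. [folklore] -/
theorem sum_splits_nil' {M : Type*} [AddCommMonoid M] (F : List α × List α → M) :
    ∑ p ∈ splits ([] : List α), F p = F ([], []) := by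
  rw [sum_splits_eq_sum_range]; simp

/-- **The bialgebra axiom** (compatibility of the shuffle coproduct with concatenation,
`Δ(G H) = Δ(G) Δ(H)`, [Reutenauer1993, §1.5]) in coefficient form:
`Sh_{GH}(u, v) = Σ_{u = u₁u₂} Σ_{v = v₁v₂} Sh_G(u₁, v₁) Sh_H(u₂, v₂)`. Proof by induction on
`|u| + |v|` from the Leibniz rule for `∂_a (G H)` and the transposed shuffle recursion.
[cite: Reutenauer1993, §1.5] -/
theorem shPair_mul (H : NCSeries α K) : ∀ (n : ℕ) (G : NCSeries α K) (u v : List α),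
    u.length + v.length ≤ n →
      shPair (G * H) u v = ∑ p ∈ splits u, ∑ q ∈ splits v, shPair G p.1 q.1 * shPair H p.2 q.2 := by
  intro n
  induction n with
  | zero =>
    intro G u v h
    have hu : u = [] := List.eq_nil_of_length_eq_zero (by omega)
    have hv : v = [] := List.eq_nil_of_length_eq_zero (by omega)
    subst hu; subst hv
    rw [sum_splits_nil', sum_splits_nil', shPair_nil_nil, shPair_nil_nil, shPair_nil_nil, mul_apply_nil']
  | succ n ih =>
    intro G u v h
    match u, v with
    | [], [] =>
      rw [sum_splits_nil', sum_splits_nil', shPair_nil_nil, shPair_nil_nil, shPair_nil_nil, mul_apply_nil']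
    | [], b :: v' =>
      simp only [List.length_nil, List.length_cons] at h
      rw [shPair_nil_cons, lderiv_mul, shPair_add, shPair_C_mul, ih _ [] v' (by simp; omega)]
      simp only [sum_splits_nil', sum_splits_cons, shPair_nil_nil, shPair_nil_cons]
    | a :: u', [] =>
      simp only [List.length_nil, List.length_cons] at h
      rw [shPair_cons_nil, lderiv_mul, shPair_add, shPair_C_mul, ih _ u' [] (by simp; omega)]
      simp only [sum_splits_nil', sum_splits_cons, shPair_nil_nil, shPair_cons_nil]
    | a :: u', b :: v' =>
      simp only [List.length_cons] at h
      rw [shPair_cons_cons, lderiv_mul, lderiv_mul, shPair_add, shPair_add, shPair_C_mul, shPair_C_mul,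
        ih _ u' (b :: v') (by simp; omega), ih _ (a :: u') v' (by simp; omega)]
      simp only [sum_splits_cons, shPair_nil_nil, shPair_cons_nil, shPair_nil_cons, shPair_cons_cons, add_mul,
        mul_add, Finset.sum_add_distrib]
      abel

/-- **Products of group-like series are group-like** (the group-like elements form a group).
[cite: Reutenauer1993, Thm 3.2] -/
theorem IsGroupLike.mul {G H : NCSeries α K} (hG : IsGroupLike G) (hH : IsGroupLike H) :
    IsGroupLike (G * H) := by
  refine ⟨by rw [mul_apply_nil', hG.1, hH.1, one_mul], fun u v => ?_⟩
  rw [← shPair, shPair_mul H _ G u v le_rfl, mul_apply, mul_apply, Finset.sum_mul_sum]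
  refine Finset.sum_congr rfl fun p _ => Finset.sum_congr rfl fun q _ => ?_
  rw [shPair, shPair, ← hG.2, ← hH.2]
  ring

/-! ## B.5a.4 Pushforward along a linear substitution of letters -/

/-- `Sh_φ(∅, ·) = φ`. [folklore] -/
theorem shPair_nil_left {β : Type*} (φ : NCSeries β K) : (fun w' => shPair φ [] w') = φ := by
  funext w'; simp [shPair]

/-- `Sh_φ(w, ∅) = φ w`. [folklore] -/
theorem shPair_nil_right {β : Type*} (φ : NCSeries β K) (w : List β) : shPair φ w [] = φ w := by
  simp [shPair]

section Push

variable {β : Type*} [Fintype β]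

/-- Auxiliary recursion for `NCSeries.push`. [folklore] -/
def pushAux (m : β → α → K) : NCSeries β K → List α → K
  | φ, [] => φ []
  | φ, f :: x => ∑ b : β, m b f * pushAux m (lderiv b φ) x

/-- **Pushforward** of `φ ∈ K⟨⟨β⟩⟩` along the linear substitution of letters `b ↦ Σ_f m(b, f) f`:
`c_x(push m φ) = Σ_{|w| = |x|} c_w(φ) ∏ᵢ m(wᵢ, xᵢ)`, the image of `φ` under the continuous algebra
map `K⟨⟨β⟩⟩ → K⟨⟨α⟩⟩` determined by the substitution (Furusho's `φ(ι(X₀), ι(X₁))` for `ι` linear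
in the letters), computed by the recursion `c_{f x}(push m φ) = Σ_b m(b,f) c_x(push m (∂_b φ))`.
[folklore] -/
def push (m : β → α → K) (φ : NCSeries β K) : NCSeries α K := fun x => pushAux m φ x

/-- `c_∅(push m φ) = c_∅(φ)`. [folklore] -/
@[simp] theorem push_nil (m : β → α → K) (φ : NCSeries β K) : push m φ [] = φ [] := rfl

/-- **Recursion**: `c_{f x}(push m φ) = Σ_b m(b, f) c_x(push m (∂_b φ))`. [folklore] -/
theorem push_cons (m : β → α → K) (φ : NCSeries β K) (f : α) (x : List α) :
    push m φ (f :: x) = ∑ b : β, m b f * push m (lderiv b φ) x := rfl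

/-- `∂_f (push m φ) = Σ_b m(b, f) • push m (∂_b φ)` as series. [folklore] -/
theorem lderiv_push (m : β → α → K) (φ : NCSeries β K) (f : α) :
    lderiv f (push m φ) = ∑ b : β, m b f • push m (lderiv b φ) := by
  ext x
  rw [lderiv_apply, push_cons]
  simp only [← coeff_apply (R := K) x, map_sum, map_smul, smul_eq_mul]

/-- `push` is additive. [folklore] -/
theorem push_add (m : β → α → K) : ∀ (x : List α) (φ ψ : NCSeries β K),
    push m (φ + ψ) x = push m φ x + push m ψ x
  | [], φ, ψ => rfl
  | f :: x, φ, ψ => by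
    rw [push_cons, push_cons, push_cons, ← Finset.sum_add_distrib]
    refine Finset.sum_congr rfl fun b _ => ?_
    rw [lderiv_add, push_add m x, mul_add]

/-- `push` is homogeneous. [folklore] -/
theorem push_smul (m : β → α → K) (c : K) : ∀ (x : List α) (φ : NCSeries β K),
    push m (c • φ) x = c * push m φ x
  | [], φ => rfl
  | f :: x, φ => by
    rw [push_cons, push_cons, Finset.mul_sum]
    refine Finset.sum_congr rfl fun b _ => ?_
    rw [show lderiv b (c • φ) = c • lderiv b φ from rfl, push_smul m c x, mul_left_comm]

/-- `push` of a right multiple by a constant. [folklore] -/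
theorem push_mul_const (m : β → α → K) (c : K) (x : List α) (φ : NCSeries β K) :
    push m (fun w => φ w * c) x = push m φ x * c := by
  rw [show (fun w => φ w * c) = c • φ from funext fun w => by simp [mul_comm], push_smul, mul_comm]

/-- `push m 0 = 0`. [folklore] -/
theorem push_zero (m : β → α → K) : ∀ x : List α, push m (0 : NCSeries β K) x = 0
  | [] => rfl
  | f :: x => by
    rw [push_cons]
    refine Finset.sum_eq_zero fun b _ => ?_
    rw [show lderiv b (0 : NCSeries β K) = 0 from rfl, push_zero m x, mul_zero]

/-- `push` commutes with finite sums. [folklore] -/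
theorem push_finset_sum (m : β → α → K) {ι : Type*} (s : Finset ι) (ψ : ι → NCSeries β K) (x : List α) :
    push m (∑ i ∈ s, ψ i) x = ∑ i ∈ s, push m (ψ i) x := by
  classical
  induction s using Finset.induction_on with
  | empty => rw [Finset.sum_empty, Finset.sum_empty, push_zero]
  | insert i s hi ih => rw [Finset.sum_insert hi, Finset.sum_insert hi, push_add, ih]

/-- The iterated pushforward of the shuffle coproduct:
`pp(x, y) = push_x (w ↦ push_y (w' ↦ Sh_φ(w, w')))`. [folklore] -/
def pushPair (m : β → α → K) (φ : NCSeries β K) (x y : List α) : K :=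
  push m (fun w => push m (fun w' => shPair φ w w') y) x

/-- `pp(∅, y) = c_y(push m φ)`. [folklore] -/
theorem pushPair_nil_left (m : β → α → K) (φ : NCSeries β K) (y : List α) :
    pushPair m φ [] y = push m φ y := by
  rw [pushPair, push_nil, shPair_nil_left]

/-- `pp(x, ∅) = c_x(push m φ)`. [folklore] -/
theorem pushPair_nil_right (m : β → α → K) (φ : NCSeries β K) (x : List α) :
    pushPair m φ x [] = push m φ x := by
  rw [pushPair]
  simp only [push_nil, shPair_nil_right]

/-- The inner recursion behind `pp`: peeling the first letter of the second block.
[folklore] -/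
theorem push_shPair_cons_left (m : β → α → K) (φ : NCSeries β K) (b : β) (w : List β) (g : α)
    (y : List α) :
    push m (fun w' => shPair φ (b :: w) w' : NCSeries β K) (g :: y) =
      push m (fun w' => shPair (lderiv b φ) w w' : NCSeries β K) (g :: y) +
        ∑ c : β, m c g * push m (fun w'' => shPair (lderiv c φ) (b :: w) w'' : NCSeries β K) y := by
  rw [push_cons, push_cons, ← Finset.sum_add_distrib]
  refine Finset.sum_congr rfl fun c _ => ?_
  rw [← mul_add, ← push_add]
  congr 2
  funext w''
  rw [lderiv_apply, add_apply, lderiv_apply, shPair_cons_cons]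

/-- Two-sided recursion for `pp`. [folklore] -/
theorem pushPair_cons_cons (m : β → α → K) (φ : NCSeries β K) (f : α) (x : List α) (g : α)
    (y : List α) :
    pushPair m φ (f :: x) (g :: y) = ∑ b : β, m b f * pushPair m (lderiv b φ) x (g :: y) +
      ∑ c : β, m c g * pushPair m (lderiv c φ) (f :: x) y := by
  -- the pieces, as series in the first block variable `w`
  set OUTER : NCSeries β K := fun w => push m (fun w' => shPair φ w w' : NCSeries β K) (g :: y) with hOUTER
  set Fb : β → NCSeries β K := fun b w => push m (fun w' => shPair (lderiv b φ) w w' : NCSeries β K) (g :: y)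
    with hFb
  set H : β → β → NCSeries β K := fun c b w =>
    push m (fun w'' => shPair (lderiv c φ) (b :: w) w'' : NCSeries β K) y with hH
  have key : ∀ b : β, lderiv b OUTER = Fb b + ∑ c : β, m c g • H c b := by
    intro b
    ext w
    have h1 : (lderiv b OUTER) w = Fb b w + ∑ c : β, m c g * H c b w := push_shPair_cons_left m φ b w g y
    rw [h1, add_apply]
    congr 1
    simp only [← coeff_apply (R := K) w, map_sum, map_smul, smul_eq_mul]
  have hL : pushPair m φ (f :: x) (g :: y) = ∑ b : β, m b f * push m (lderiv b OUTER) x := push_cons m OUTER f x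
  rw [hL]
  simp only [key, push_add, push_finset_sum, push_smul, mul_add, Finset.sum_add_distrib, Finset.mul_sum]
  congr 1
  rw [Finset.sum_comm]
  refine Finset.sum_congr rfl fun c _ => ?_
  have hR : pushPair m (lderiv c φ) (f :: x) y =
      ∑ b : β, m b f * push m (H c b) x := push_cons m _ f x
  rw [hR, Finset.mul_sum]
  refine Finset.sum_congr rfl fun b _ => ?_
  ring

/-- **The shuffle coproduct of a pushforward** (a linear substitution of letters is a bialgebra
map): `Sh_{push m φ}(x, y) = pp(x, y)`, for every series `φ`. [folklore] -/
theorem shPair_push_eq_pushPair (m : β → α → K) : ∀ (n : ℕ) (φ : NCSeries β K) (x y : List α),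
    x.length + y.length ≤ n → shPair (push m φ) x y = pushPair m φ x y := by
  intro n
  induction n with
  | zero =>
    intro φ x y h
    have hx : x = [] := List.eq_nil_of_length_eq_zero (by omega)
    have hy : y = [] := List.eq_nil_of_length_eq_zero (by omega)
    subst hx; subst hy
    rw [shPair_nil_nil, pushPair_nil_left, push_nil]
  | succ n ih =>
    intro φ x y h
    match x, y with
    | [], y => rw [pushPair_nil_left]; exact congrFun (shPair_nil_left (push m φ)) y
    | f :: x', [] => rw [pushPair_nil_right, shPair_nil_right]
    | f :: x', g :: y' =>
      simp only [List.length_cons] at h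
      rw [shPair_cons_cons, lderiv_push, lderiv_push, shPair_finset_sum, shPair_finset_sum,
        pushPair_cons_cons]
      simp only [shPair_smul]
      congr 1
      · refine Finset.sum_congr rfl fun b _ => ?_
        rw [ih _ x' (g :: y') (by simp; omega)]
      · refine Finset.sum_congr rfl fun c _ => ?_
        rw [ih _ (f :: x') y' (by simp; omega)]

/-- **Pushforwards of group-like series are group-like.** [cite: Reutenauer1993, Thm 3.2] -/
theorem IsGroupLike.push (m : β → α → K) {φ : NCSeries β K} (hφ : IsGroupLike φ) :
    IsGroupLike (push m φ) := by
  refine ⟨by rw [push_nil, hφ.1], fun x y => ?_⟩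
  rw [← shPair, shPair_push_eq_pushPair m _ φ x y le_rfl, pushPair]
  have hsh : ∀ w : List β, (fun w' => shPair φ w w') = fun w' => φ w' * φ w := by
    intro w; funext w'; rw [shPair, ← hφ.2, mul_comm]
  simp only [hsh, push_mul_const]
  rw [show (fun w => NCSeries.push m φ y * φ w : NCSeries β K) = NCSeries.push m φ y • φ from rfl, push_smul,
    mul_comm]

/-! ### Monomial substitutions -/

variable [DecidableEq β]

/-- A "monomial" substitution: each target letter `f` has at most one preimage letter `b` with a
coefficient `c`, recorded as `pre f = some (b, c)`. [folklore] -/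
def monoSubst (pre : α → Option (β × K)) : β → α → K := fun b f =>
  match pre f with
  | some (b', c) => if b' = b then c else 0
  | none => 0

/-- The preimage word and the product of coefficients of a word under a monomial substitution
(`none` if some letter has no preimage). [folklore] -/
def preWord (pre : α → Option (β × K)) : List α → Option (List β × K)
  | [] => some ([], 1)
  | f :: x =>
    match pre f, preWord pre x with
    | some (b, c), some (w, c') => some (b :: w, c * c')
    | _, _ => none

/-- **Closed form of a monomial pushforward**: `c_x(push m φ) = (∏ coeff) · c_{preimage}(φ)` if
every letter of `x` has a preimage, and `0` otherwise. [folklore] -/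
theorem push_monoSubst (pre : α → Option (β × K)) : ∀ (x : List α) (φ : NCSeries β K),
    push (monoSubst pre) φ x =
      match preWord pre x with
      | some (w, c) => c * φ w
      | none => 0
  | [], φ => by simp [preWord]
  | f :: x, φ => by
    rw [push_cons]
    have ih := fun ψ => push_monoSubst pre x ψ
    rcases hpre : pre f with _ | ⟨b, c⟩
    · -- no preimage: every term vanishes
      have h0 : ∀ b', monoSubst pre b' f = 0 := fun b' => by simp [monoSubst, hpre]
      simp only [h0, zero_mul, Finset.sum_const_zero, preWord, hpre]
    · have hb : ∀ b', monoSubst pre b' f = if b = b' then c else 0 := fun b' => by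
        simp [monoSubst, hpre]
      simp only [hb, ite_mul, zero_mul, Finset.sum_ite_eq, Finset.mem_univ, ↓reduceIte, ih]
      simp only [preWord, hpre]
      rcases preWord pre x with _ | ⟨w, c'⟩
      · simp
      · simp [lderiv_apply, mul_assoc]

end Push

end NCSeries

/-! ## B.5a.5 Pairing with a product of series (deconcatenation) -/

section PairMul

variable {α : Type u} {K : Type v} [CommRing K] [Fintype α]

/-- Transport of a sum over `Fin n`-words along `n = n'`. [folklore] -/
theorem sum_fin_congr {M : Type*} [AddCommMonoid M] {n n' : ℕ} (h : n = n') (F : List α → M) :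
    ∑ f : Fin n → α, F (List.ofFn f) = ∑ f : Fin n' → α, F (List.ofFn f) := by
  subst h; rfl

/-- **Cutting words of length `k + j` at `k`**: summing `H(prefix, suffix)` over all words is summing
over all pairs of words of lengths `k` and `j`. [folklore] -/
theorem sum_fin_add_take_drop {M : Type*} [AddCommMonoid M] (k j : ℕ) (H : List α → List α → M) :
    ∑ f : Fin (k + j) → α, H ((List.ofFn f).take k) ((List.ofFn f).drop k) =
      ∑ x : Fin k → α, ∑ y : Fin j → α, H (List.ofFn x) (List.ofFn y) := by
  rw [← Fintype.sum_prod_type']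
  refine (Fintype.sum_equiv (Fin.appendEquiv k j) _ _ fun p => ?_).symm
  show H _ _ = H (List.take k (List.ofFn (Fin.append p.1 p.2))) (List.drop k (List.ofFn (Fin.append p.1 p.2)))
  rw [List.ofFn_fin_append, List.take_left' (by simp), List.drop_left' (by simp)]

/-- **Pairing with a product**: `⟨ψ, P Q⟩_n = Σ_{k+j=n} Σ_{|x|=k,|y|=j} ψ(x y) c_x(P) c_y(Q)`.
[folklore] -/
theorem pairLen_mul (n : ℕ) (ψ : List α → K) (P Q : NCSeries α K) :
    pairLen n ψ (P * Q) = ∑ p ∈ Finset.HasAntidiagonal.antidiagonal n,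
      ∑ x : Fin p.1 → α, ∑ y : Fin p.2 → α,
        ψ (List.ofFn x ++ List.ofFn y) * (P (List.ofFn x) * Q (List.ofFn y)) := by
  unfold pairLen
  have h1 : ∀ f : Fin n → α, ψ (List.ofFn f) * (P * Q) (List.ofFn f) =
      ∑ k ∈ Finset.range (n + 1), ψ ((List.ofFn f).take k ++ (List.ofFn f).drop k) *
        (P ((List.ofFn f).take k) * Q ((List.ofFn f).drop k)) := by
    intro f
    rw [NCSeries.mul_apply, NCSeries.sum_splits_eq_sum_range, List.length_ofFn, Finset.mul_sum]
    refine Finset.sum_congr rfl fun k _ => ?_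
    rw [List.take_append_drop]
  rw [Finset.sum_congr rfl fun f _ => h1 f, Finset.sum_comm,
    Finset.Nat.sum_antidiagonal_eq_sum_range_succ_mk]
  refine Finset.sum_congr rfl fun k hk => ?_
  rw [Finset.mem_range] at hk
  rw [sum_fin_congr (show n = k + (n - k) by omega)
    (fun l => ψ (l.take k ++ l.drop k) * (P (l.take k) * Q (l.drop k))),
    sum_fin_add_take_drop k (n - k) (fun a b => ψ (a ++ b) * (P a * Q b))]

end PairMul

/-! ## B.5a.6 Homogeneous functionals; weights and supports of the bar elements -/

section HomogLemmas

variable {α : Type u} {K : Type v} [CommRing K] [Fintype α]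

omit [Fintype α] in
/-- `0` is homogeneous of every weight. [folklore] -/
theorem homog_zero (W : ℕ) : Homog W (0 : List α → K) := fun _ _ => rfl

omit [Fintype α] in
/-- Homogeneous functionals of a weight are closed under addition. [folklore] -/
theorem Homog.add {W : ℕ} {ψ ψ' : List α → K} (h : Homog W ψ) (h' : Homog W ψ') : Homog W (ψ + ψ') :=
  fun w hw => by simp [h w hw, h' w hw]

omit [Fintype α] in
/-- Homogeneous functionals of a weight are closed under subtraction. [folklore] -/
theorem Homog.sub {W : ℕ} {ψ ψ' : List α → K} (h : Homog W ψ) (h' : Homog W ψ') : Homog W (ψ - ψ') :=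
  fun w hw => by simp [h w hw, h' w hw]

omit [Fintype α] in
/-- Homogeneous functionals of a weight are closed under negation. [folklore] -/
theorem Homog.neg {W : ℕ} {ψ : List α → K} (h : Homog W ψ) : Homog W (-ψ) :=
  fun w hw => by simp [h w hw]

omit [Fintype α] in
/-- **Recursive characterisation**: `ψ` is homogeneous of weight `W + 1` iff `ψ(∅) = 0` and all
`∂_f ψ` are homogeneous of weight `W`. [folklore] -/
theorem homog_succ_iff {W : ℕ} {ψ : List α → K} :
    Homog (W + 1) ψ ↔ ψ [] = 0 ∧ ∀ f, Homog W (derK f ψ) := by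
  constructor
  · intro h
    exact ⟨h [] (by simp), fun f w hw => h (f :: w) (by simpa using hw)⟩
  · rintro ⟨h0, h1⟩ w hw
    cases w with
    | nil => exact h0
    | cons f w => exact h1 f w (by simpa using hw)

omit [Fintype α] in
/-- A functional of weight `0` vanishes on nonempty words, so its components are `0`. [folklore] -/
theorem derK_eq_zero_of_homog_zero {ψ : List α → K} (h : Homog 0 ψ) (f : α) : derK f ψ = 0 :=
  funext fun w => h (f :: w) (by simp)

omit [Fintype α] in
/-- `0 ш ψ' = 0`. [folklore] -/
theorem shufK_zero_left (ψ' : List α → K) : shufK 0 ψ' = 0 := by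
  suffices h : ∀ (w : List α) (ψ' : List α → K), shufK 0 ψ' w = 0 from funext fun w => h w ψ'
  intro w
  induction w with
  | nil => intro ψ'; simp
  | cons f w ih =>
    intro ψ'
    rw [shufK_cons, show derK f (0 : List α → K) = 0 from rfl, ih, ih, add_zero]

omit [Fintype α] in
/-- `ψ ш 0 = 0`. [folklore] -/
theorem shufK_zero_right (ψ : List α → K) : shufK ψ 0 = 0 := by
  suffices h : ∀ (w : List α) (ψ : List α → K), shufK ψ 0 w = 0 from funext fun w => h w ψ
  intro w
  induction w with
  | nil => intro ψ; simp
  | cons f w ih =>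
    intro ψ
    rw [shufK_cons, show derK f (0 : List α → K) = 0 from rfl, ih, ih, add_zero]

omit [Fintype α] in
/-- **The shuffle product is graded**: `ψ` of weight `W` and `ψ'` of weight `W'` give `ψ ш ψ'` of
weight `W + W'`. [folklore] -/
theorem homog_shufK : ∀ {W W' : ℕ} {ψ ψ' : List α → K}, Homog W ψ → Homog W' ψ' →
    Homog (W + W') (shufK ψ ψ') := by
  suffices h : ∀ (w : List α) {W W' : ℕ} {ψ ψ' : List α → K}, Homog W ψ → Homog W' ψ' →
      w.length ≠ W + W' → shufK ψ ψ' w = 0 from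
    fun {W W' ψ ψ'} hψ hψ' w hw => h w hψ hψ' hw
  intro w
  induction w with
  | nil =>
    intro W W' ψ ψ' hψ hψ' hw
    rw [shufK_nil]
    rcases Nat.eq_zero_or_pos W with h0 | h0
    · have hW' : W' ≠ 0 := by simp at hw; omega
      rw [hψ' [] (by simpa using hW'.symm), mul_zero]
    · rw [hψ [] (by simp; omega), zero_mul]
  | cons f w ih =>
    intro W W' ψ ψ' hψ hψ' hw
    rw [shufK_cons]
    have h1 : shufK (derK f ψ) ψ' w = 0 := by
      rcases W with _ | W
      · rw [derK_eq_zero_of_homog_zero hψ, shufK_zero_left]; rfl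
      · exact ih ((homog_succ_iff.mp hψ).2 f) hψ' (by simp at hw; omega)
    have h2 : shufK ψ (derK f ψ') w = 0 := by
      rcases W' with _ | W'
      · rw [derK_eq_zero_of_homog_zero hψ', shufK_zero_right]; rfl
      · exact ih hψ ((homog_succ_iff.mp hψ').2 f) (by simp at hw; omega)
    rw [h1, h2, add_zero]

end HomogLemmas

namespace BarFun

open F5

/-- Homogeneity of a bar element is inherited by its cast. [folklore] -/
theorem homog_castK {K : Type v} [CommRing K] {W : ℕ} {L : BarFun} (h : Homog W L) :
    Homog W (castK (K := K) L) := fun w hw => by simp [h w hw]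

/-- The unit is homogeneous of weight `0`. [folklore] -/
theorem homog_unit : Homog 0 unit := fun w hw => by
  cases w with
  | nil => simp at hw
  | cons f w => rfl

/-- Prefixing raises the weight by one. [folklore] -/
theorem Homog.pre {W : ℕ} {L : BarFun} (h : Homog W L) (f : F5) : Homog (W + 1) (pre f L) := by
  intro w hw
  cases w with
  | nil => rfl
  | cons x w =>
    rw [pre_cons]
    split_ifs
    · exact h w (by simpa using hw)
    · rfl

/-- **`l^x_s` has weight `|s|` (= `Σ sᵢ`).** [folklore] -/
theorem homog_lx : ∀ s : List ℕ, Homog s.sum (lx s)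
  | [] => by rw [lx_nil]; exact homog_unit
  | 0 :: _ => by rw [lx_zero]; exact homog_zero _
  | 1 :: s' => by rw [lx_one, List.sum_cons, add_comm]; exact Homog.pre (homog_lx s') a1
  | (c + 2) :: s' => by
    rw [lx_two, List.sum_cons, show c + 2 + s'.sum = ((c + 1) :: s').sum + 1 by simp; omega]
    exact Homog.pre (homog_lx ((c + 1) :: s')) a0
termination_by s => s.sum + s.length
decreasing_by all_goals simp_wf <;> omega

/-- `l^y_s` has weight `Σ sᵢ`. [folklore] -/
theorem homog_ly : ∀ s : List ℕ, Homog s.sum (ly s)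
  | [] => by rw [ly_nil]; exact homog_unit
  | 0 :: _ => by rw [ly_zero]; exact homog_zero _
  | 1 :: s' => by rw [ly_one, List.sum_cons, add_comm]; exact Homog.pre (homog_ly s') b1
  | (c + 2) :: s' => by
    rw [ly_two, List.sum_cons, show c + 2 + s'.sum = ((c + 1) :: s').sum + 1 by simp; omega]
    exact Homog.pre (homog_ly ((c + 1) :: s')) b0
termination_by s => s.sum + s.length
decreasing_by all_goals simp_wf <;> omega

/-- `l^{xy}_s` has weight `Σ sᵢ`. [folklore] -/
theorem homog_lxyD : ∀ s : List ℕ, Homog s.sum (lxyD s)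
  | [] => by rw [lxyD_nil]; exact homog_unit
  | 0 :: _ => by rw [lxyD_zero]; exact homog_zero _
  | 1 :: s' => by rw [lxyD_one, List.sum_cons, add_comm]; exact Homog.pre (homog_lxyD s') g
  | (c + 2) :: s' => by
    rw [lxyD_two, List.sum_cons, show c + 2 + s'.sum = ((c + 1) :: s').sum + 1 by simp; omega]
    exact Homog.add (Homog.pre (homog_lxyD ((c + 1) :: s')) a0) (Homog.pre (homog_lxyD ((c + 1) :: s')) b0)
termination_by s => s.sum + s.length
decreasing_by all_goals simp_wf <;> omega

/-- **`l^{x,y}_{s,t}` has weight `Σ sᵢ + Σ tⱼ`** (indices with positive entries).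
[folklore] -/
theorem homog_lxy : ∀ (n : ℕ) (s t : List ℕ), (∀ i ∈ s, 1 ≤ i) → (∀ i ∈ t, 1 ≤ i) →
    msz s t ≤ n → Homog (s.sum + t.sum) (lxy s t) := by
  intro n
  induction n with
  | zero =>
    intro s t hs ht hn
    have hs0 : s = [] := by
      cases s with
      | nil => rfl
      | cons a w => simp [msz] at hn
    have ht0 : t = [] := by
      cases t with
      | nil => rfl
      | cons a w => simp [msz] at hn
    subst hs0; subst ht0
    rw [lxy_nil_left, ly_nil]; exact homog_unit
  | succ n ih =>
    intro s t hs ht hn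
    cases s with
    | nil => rw [lxy_nil_left, List.sum_nil, zero_add]; exact homog_ly t
    | cons c s' =>
      cases t with
      | nil => rw [lxy_nil_right, List.sum_nil, add_zero]; exact homog_lxyD _
      | cons d t'' =>
        obtain ⟨c, rfl⟩ : ∃ c₀, c = c₀ + 1 := ⟨c - 1, by have := hs c (by simp); omega⟩
        obtain ⟨d, rfl⟩ : ∃ d₀, d = d₀ + 1 := ⟨d - 1, by have := ht d (by simp); omega⟩
        have hs' : ∀ i ∈ s', 1 ≤ i := fun i hi => hs i (by simp [hi])
        have ht'' : ∀ i ∈ t'', 1 ≤ i := fun i hi => ht i (by simp [hi])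
        obtain ⟨hb1, ht'⟩ := pos_cons_getLast_dropLast ht'' d
        have hsum := sum_dropLast_add_getLast ((d + 1) :: t'') (List.cons_ne_nil _ _)
        have hlen : ((d + 1) :: t'').dropLast.length + 1 = t''.length + 1 := by
          rw [List.length_dropLast]; simp
        simp only [msz, List.sum_cons, List.length_cons] at hn
        have hbs : ∀ i ∈ ((d + 1) :: t'').getLast (List.cons_ne_nil _ _) :: s', 1 ≤ i := by
          intro i hi
          rcases List.mem_cons.mp hi with h | h
          · rw [h]; exact hb1
          · exact hs' i h
        have hmb : msz (((d + 1) :: t'').getLast (List.cons_ne_nil _ _) :: s') ((d + 1) :: t'').dropLast ≤ n := by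
          simp only [msz, List.sum_cons, List.length_cons] at hsum ⊢
          omega
        -- the weight, as `W + 1`
        rw [show ((c + 1) :: s').sum + ((d + 1) :: t'').sum = (c + s'.sum + (d + 1) + t''.sum) + 1 by
          simp; omega]
        refine (homog_succ_iff (K := ℤ)).mpr ⟨lxy_succ_succ_nil c s' d t'', fun f => ?_⟩
        show Homog (c + s'.sum + (d + 1) + t''.sum) (der f (lxy ((c + 1) :: s') ((d + 1) :: t'')))
        cases f with
        | g => rw [der_g_lxy_right_succ]; exact homog_zero _
        | b0 =>
          rcases d with _ | d₀
          · rw [der_b0_lxy_right_one]; exact homog_zero _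
          · rw [der_b0_lxy_right_two]
            have h := ih _ _ hs (fun i hi => by
              rcases List.mem_cons.mp hi with h | h
              · omega
              · exact ht'' i h) (show msz ((c + 1) :: s') ((d₀ + 1) :: t'') ≤ n by
                simp only [msz, List.sum_cons, List.length_cons]; omega)
            rwa [show ((c + 1) :: s').sum + ((d₀ + 1) :: t'').sum = c + s'.sum + (d₀ + 1 + 1) + t''.sum by
              simp; omega] at h
        | b1 =>
          rcases d with _ | d₀
          · rw [der_b1_lxy_right_one]
            have h := ih _ _ hs ht'' (show msz ((c + 1) :: s') t'' ≤ n by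
              simp only [msz, List.sum_cons, List.length_cons]; omega)
            rwa [show ((c + 1) :: s').sum + t''.sum = c + s'.sum + (0 + 1) + t''.sum by simp; omega] at h
          · rw [der_b1_lxy_right_two]; exact homog_zero _
        | a0 =>
          rcases c with _ | c₀
          · rw [der_a0_lxy_one]
            have h := ih _ _ hbs ht' hmb
            refine Homog.neg ?_
            rwa [show (((d + 1) :: t'').getLast (List.cons_ne_nil _ _) :: s').sum +
              ((d + 1) :: t'').dropLast.sum = 0 + s'.sum + (d + 1) + t''.sum by
                simp only [List.sum_cons] at hsum ⊢; omega] at h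
          · rw [der_a0_lxy_two]
            have h := ih _ _ (fun i hi => by
              rcases List.mem_cons.mp hi with h | h
              · omega
              · exact hs' i h) ht (show msz ((c₀ + 1) :: s') ((d + 1) :: t'') ≤ n by
                simp only [msz, List.sum_cons, List.length_cons]; omega)
            rwa [show ((c₀ + 1) :: s').sum + ((d + 1) :: t'').sum = c₀ + 1 + s'.sum + (d + 1) + t''.sum by
              simp; omega] at h
        | a1 =>
          rcases c with _ | c₀
          · rw [der_a1_lxy_one]
            refine Homog.sub ?_ ?_
            · have h := ih _ _ hs' ht (show msz s' ((d + 1) :: t'') ≤ n by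
                simp only [msz, List.sum_cons, List.length_cons]; omega)
              rwa [show s'.sum + ((d + 1) :: t'').sum = 0 + s'.sum + (d + 1) + t''.sum by simp; omega] at h
            · have h := ih _ _ hbs ht' hmb
              rwa [show (((d + 1) :: t'').getLast (List.cons_ne_nil _ _) :: s').sum +
                ((d + 1) :: t'').dropLast.sum = 0 + s'.sum + (d + 1) + t''.sum by
                  simp only [List.sum_cons] at hsum ⊢; omega] at h
          · rw [der_a1_lxy_two]; exact homog_zero _

/-- **`l^{x,y}` and `l^{y,x}` have weight `Σ sᵢ + Σ tⱼ`**, packaged. [folklore] -/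
theorem homog_lxy' {s t : List ℕ} (hs : ∀ i ∈ s, 1 ≤ i) (ht : ∀ i ∈ t, 1 ≤ i) :
    Homog (s.sum + t.sum) (lxy s t) ∧ Homog (s.sum + t.sum) (lyx s t) := by
  have h := homog_lxy _ s t hs ht le_rfl
  refine ⟨h, fun w hw => ?_⟩
  rw [lyx, swapL_apply]
  exact h _ (by simpa using hw)

/-! ### Supports: last letters and `{α₁, β₁}`-prefixes -/

/-- `L` **ends in `β₁` or `γ`**: it vanishes on words ending with `α₀`, `α₁` or `β₀`. [folklore] -/
def EndsBG (L : BarFun) : Prop := ∀ (w : List F5) (f : F5), (f = a0 ∨ f = a1 ∨ f = b0) → L (w ++ [f]) = 0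

/-- `0` ends in `β₁`/`γ` (vacuously). [folklore] -/
theorem endsBG_zero : EndsBG 0 := fun _ _ _ => rfl

/-- `EndsBG` is closed under sums. [folklore] -/
theorem EndsBG.add {L L' : BarFun} (h : EndsBG L) (h' : EndsBG L') : EndsBG (L + L') :=
  fun w f hf => by simp [h w f hf, h' w f hf]

/-- `EndsBG` is closed under differences. [folklore] -/
theorem EndsBG.sub {L L' : BarFun} (h : EndsBG L) (h' : EndsBG L') : EndsBG (L - L') :=
  fun w f hf => by simp [h w f hf, h' w f hf]

/-- `EndsBG` is closed under negation. [folklore] -/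
theorem EndsBG.neg {L : BarFun} (h : EndsBG L) : EndsBG (-L) := fun w f hf => by simp [h w f hf]

/-- Prefixing preserves `EndsBG` when the inner functional has no constant term (or the prefix
letter is `β₁`/`γ`). [folklore] -/
theorem EndsBG.pre {L : BarFun} (h : EndsBG L) (f' : F5) (h0 : L [] = 0 ∨ f' = b1 ∨ f' = g) :
    EndsBG (pre f' L) := by
  intro w f hf
  cases w with
  | nil =>
    rw [List.nil_append, pre_cons]
    split_ifs with hx
    · subst hx
      rcases h0 with h0 | h0 | h0
      · exact h0
      · rcases hf with rfl | rfl | rfl <;> cases h0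
      · rcases hf with rfl | rfl | rfl <;> cases h0
    · rfl
  | cons x w =>
    rw [List.cons_append, pre_cons]
    split_ifs
    · exact h w f hf
    · rfl

/-- A functional ending in `β₁`/`γ`, read off from its components: `L(∅) = 0`… more precisely
`L [f] = 0` for the three letters and all `∂_x L` end in `β₁`/`γ`. [folklore] -/
theorem endsBG_of_der {L : BarFun} (h1 : ∀ f, (f = a0 ∨ f = a1 ∨ f = b0) → L [f] = 0)
    (h : ∀ x, EndsBG (der x L)) : EndsBG L := by
  intro w f hf
  cases w with
  | nil => exact h1 f hf
  | cons x w => exact h x w f hf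

/-- `l^y_t` ends in `β₁` (for `t ≠ ∅` with positive entries). [folklore] -/
theorem endsBG_ly : ∀ t : List ℕ, (∀ i ∈ t, 1 ≤ i) → t ≠ [] → EndsBG (ly t)
  | [], _, h => absurd rfl h
  | 0 :: _, ht, _ => absurd (ht 0 (by simp)) (by omega)
  | [1], _, _ => by
    rw [ly_one, ly_nil]; exact EndsBG.pre (fun w f hf => by cases w <;> rfl) b1 (Or.inr (Or.inl rfl))
  | 1 :: e :: t'', ht, _ => by
    rw [ly_one]
    exact EndsBG.pre (endsBG_ly (e :: t'') (fun i hi => ht i (by simp [hi])) (List.cons_ne_nil _ _)) b1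
      (Or.inr (Or.inl rfl))
  | (d + 2) :: t', ht, _ => by
    rw [ly_two]
    refine EndsBG.pre (endsBG_ly ((d + 1) :: t') (fun i hi => ?_) (List.cons_ne_nil _ _)) b0
      (Or.inl (ly_cons_nil d t'))
    rcases List.mem_cons.mp hi with h | h
    · omega
    · exact ht i (by simp [h])
termination_by t => t.sum + t.length
decreasing_by all_goals simp_wf <;> omega

/-- `l^{xy}_u` ends in `γ` (for `u ≠ ∅` with positive entries). [folklore] -/
theorem endsBG_lxyD : ∀ u : List ℕ, (∀ i ∈ u, 1 ≤ i) → u ≠ [] → EndsBG (lxyD u)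
  | [], _, h => absurd rfl h
  | 0 :: _, hu, _ => absurd (hu 0 (by simp)) (by omega)
  | [1], _, _ => by
    rw [lxyD_one, lxyD_nil]; exact EndsBG.pre (fun w f hf => by cases w <;> rfl) g (Or.inr (Or.inr rfl))
  | 1 :: e :: u'', hu, _ => by
    rw [lxyD_one]
    exact EndsBG.pre (endsBG_lxyD (e :: u'') (fun i hi => hu i (by simp [hi])) (List.cons_ne_nil _ _)) g
      (Or.inr (Or.inr rfl))
  | (c + 2) :: u', hu, _ => by
    rw [lxyD_two]
    have h := endsBG_lxyD ((c + 1) :: u') (fun i hi => by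
      rcases List.mem_cons.mp hi with h | h
      · omega
      · exact hu i (by simp [h])) (List.cons_ne_nil _ _)
    exact EndsBG.add (EndsBG.pre h a0 (Or.inl (lxyD_cons_nil c u'))) (EndsBG.pre h b0 (Or.inl (lxyD_cons_nil c u')))
termination_by u => u.sum + u.length
decreasing_by all_goals simp_wf <;> omega

/-- **`l^{x,y}_{s,t}` ends in `β₁` or `γ`** for `(s, t) ≠ (∅, ∅)` with positive entries (Furusho:
"each term [of `l^{x,y}`, `l^{xy}`] contains at least one `dy/y`, `dy/(1-y)` or `γ`", innermost;
[Furusho2011, proof of Lemma 5.1]). [cite: Furusho2011, Lemma 5.1 (proof)] -/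
theorem endsBG_lxy : ∀ (n : ℕ) (s t : List ℕ), (∀ i ∈ s, 1 ≤ i) → (∀ i ∈ t, 1 ≤ i) →
    (s ≠ [] ∨ t ≠ []) → msz s t ≤ n → EndsBG (lxy s t) := by
  intro n
  induction n with
  | zero =>
    intro s t hs ht hne hn
    exfalso
    rcases hne with h | h
    · cases s with
      | nil => exact h rfl
      | cons a w => simp [msz] at hn
    · cases t with
      | nil => exact h rfl
      | cons a w => simp [msz] at hn
  | succ n ih =>
    intro s t hs ht hne hn
    cases s with
    | nil =>
      rw [lxy_nil_left]
      exact endsBG_ly t ht (hne.resolve_left fun h => h rfl)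
    | cons c s' =>
      cases t with
      | nil => rw [lxy_nil_right]; exact endsBG_lxyD _ hs (List.cons_ne_nil _ _)
      | cons d t'' =>
        obtain ⟨c, rfl⟩ : ∃ c₀, c = c₀ + 1 := ⟨c - 1, by have := hs c (by simp); omega⟩
        obtain ⟨d, rfl⟩ : ∃ d₀, d = d₀ + 1 := ⟨d - 1, by have := ht d (by simp); omega⟩
        have hs' : ∀ i ∈ s', 1 ≤ i := fun i hi => hs i (by simp [hi])
        have ht'' : ∀ i ∈ t'', 1 ≤ i := fun i hi => ht i (by simp [hi])
        obtain ⟨hb1, ht'⟩ := pos_cons_getLast_dropLast ht'' d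
        have hsum := sum_dropLast_add_getLast ((d + 1) :: t'') (List.cons_ne_nil _ _)
        have hlen : ((d + 1) :: t'').dropLast.length + 1 = t''.length + 1 := by
          rw [List.length_dropLast]; simp
        simp only [msz, List.sum_cons, List.length_cons] at hn
        have hbs : ∀ i ∈ ((d + 1) :: t'').getLast (List.cons_ne_nil _ _) :: s', 1 ≤ i := by
          intro i hi
          rcases List.mem_cons.mp hi with h | h
          · rw [h]; exact hb1
          · exact hs' i h
        have hmb : msz (((d + 1) :: t'').getLast (List.cons_ne_nil _ _) :: s') ((d + 1) :: t'').dropLast ≤ n := by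
          simp only [msz, List.sum_cons, List.length_cons] at hsum ⊢
          omega
        refine endsBG_of_der (fun f hf => ?_) fun f => ?_
        · -- single letters: weight ≥ 2 ... the value `L [f]` is `(der f L) []`
          show (der f (lxy ((c + 1) :: s') ((d + 1) :: t''))) [] = 0
          rcases hf with rfl | rfl | rfl
          · rcases c with _ | c₀
            · rw [der_a0_lxy_one]
              show -(lxy _ _ []) = 0
              rcases hq : ((d + 1) :: t'').dropLast with _ | ⟨y, q⟩
              · rw [lxy_nil_right]
                obtain ⟨b, hb⟩ : ∃ b, ((d + 1) :: t'').getLast (List.cons_ne_nil _ _) = b + 1 := ⟨_, (Nat.succ_pred_eq_of_pos hb1).symm⟩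
                rw [hb, lxyD_cons_nil, neg_zero]
              · have hy : 1 ≤ y := ht' y (by rw [hq]; simp)
                obtain ⟨b, hb⟩ : ∃ b, ((d + 1) :: t'').getLast (List.cons_ne_nil _ _) = b + 1 := ⟨_, (Nat.succ_pred_eq_of_pos hb1).symm⟩
                obtain ⟨y', rfl⟩ : ∃ y', y = y' + 1 := ⟨y - 1, by omega⟩
                rw [hb, lxy_succ_succ_nil, neg_zero]
            · rw [der_a0_lxy_two, lxy_succ_succ_nil]
          · rcases c with _ | c₀
            · rw [der_a1_lxy_one]
              show lxy _ _ [] - lxy _ _ [] = 0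
              have h1 : lxy s' ((d + 1) :: t'') [] = 0 := by
                cases s' with
                | nil => rw [lxy_nil_left, ly_cons_nil]
                | cons e s'' =>
                  obtain ⟨e', rfl⟩ : ∃ e', e = e' + 1 := ⟨e - 1, by have := hs' e (by simp); omega⟩
                  exact lxy_succ_succ_nil e' s'' d t''
              have h2 : lxy (((d + 1) :: t'').getLast (List.cons_ne_nil _ _) :: s') ((d + 1) :: t'').dropLast [] = 0 := by
                obtain ⟨b, hb⟩ : ∃ b, ((d + 1) :: t'').getLast (List.cons_ne_nil _ _) = b + 1 := ⟨_, (Nat.succ_pred_eq_of_pos hb1).symm⟩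
                rcases hq : ((d + 1) :: t'').dropLast with _ | ⟨y, q⟩
                · rw [hb, lxy_nil_right, lxyD_cons_nil]
                · have hy : 1 ≤ y := ht' y (by rw [hq]; simp)
                  obtain ⟨y', rfl⟩ : ∃ y', y = y' + 1 := ⟨y - 1, by omega⟩
                  rw [hb, lxy_succ_succ_nil]
              rw [h1, h2, sub_zero]
            · rw [der_a1_lxy_two]; rfl
          · rcases d with _ | d₀
            · rw [der_b0_lxy_right_one]; rfl
            · rw [der_b0_lxy_right_two, lxy_succ_succ_nil]
        · cases f with
          | g => rw [der_g_lxy_right_succ]; exact endsBG_zero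
          | b0 =>
            rcases d with _ | d₀
            · rw [der_b0_lxy_right_one]; exact endsBG_zero
            · rw [der_b0_lxy_right_two]
              exact ih _ _ hs (fun i hi => by
                rcases List.mem_cons.mp hi with h | h
                · omega
                · exact ht'' i h) (Or.inl (List.cons_ne_nil _ _))
                (by simp only [msz, List.sum_cons, List.length_cons]; omega)
          | b1 =>
            rcases d with _ | d₀
            · rw [der_b1_lxy_right_one]
              exact ih _ _ hs ht'' (Or.inl (List.cons_ne_nil _ _))
                (by simp only [msz, List.sum_cons, List.length_cons]; omega)
            · rw [der_b1_lxy_right_two]; exact endsBG_zero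
          | a0 =>
            rcases c with _ | c₀
            · rw [der_a0_lxy_one]
              exact EndsBG.neg (ih _ _ hbs ht' (Or.inl (List.cons_ne_nil _ _)) hmb)
            · rw [der_a0_lxy_two]
              exact ih _ _ (fun i hi => by
                rcases List.mem_cons.mp hi with h | h
                · omega
                · exact hs' i h) ht (Or.inl (List.cons_ne_nil _ _))
                (by simp only [msz, List.sum_cons, List.length_cons]; omega)
          | a1 =>
            rcases c with _ | c₀
            · rw [der_a1_lxy_one]
              exact EndsBG.sub (ih _ _ hs' ht (Or.inr (List.cons_ne_nil _ _))
                (by simp only [msz, List.sum_cons, List.length_cons]; omega))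
                (ih _ _ hbs ht' (Or.inl (List.cons_ne_nil _ _)) hmb)
            · rw [der_a1_lxy_two]; exact endsBG_zero

end BarFun




end Literature.NumberTheory.Transcendental
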